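import Mathlib.Analysis.SpecialFunctions.Pow.Real
import Mathlib.Topology.Order.Basic
import Literature.Computability.Cryptography.WordRAM
import Literature.Computability.Cryptography.FGComplexity
import Literature.Computability.Cryptography.FGComplexityProofs
import Literature.Computability.Cryptography.FGProblemZoo
import Literature.Computability.FineGrained.FineGrainedWave0
import HarnessLib
import HarnessLib.Audit

-- provenance: harness21/H21/H21/Statements/FineGrained/Conjectures.lean @ a516ff0 (interim HEAD d8f2665); M5 mechanical rewrite
/-!
# Fine-grained complexity: the central conjectures (family `fine-grained`)

Statement file for the polynomial-time hardness hypotheses of fine-grained complexity, over the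
word RAM of `Literature.Prelude.CryptoQuantFine.WordRAM` and the complexity layer / problem zoo of
`Literature.Prelude.CryptoQuantFine.FGComplexity`, `Literature.Prelude.CryptoQuantFine.FGProblemZoo`:

* **fine-grained.S07** the word-RAM model (Fredman–Willard 1993; V. Vassilevska Williams,
  ICM 2018, §2): characterisation lemmas `inTime_iff`, `randInTime_iff`
  unfolding the prelude's running-time predicates to the textbook wording;
* **fine-grained.S08** the OV conjecture `OVConjecture` (the `d = c log n` hardness hypothesis
  for Orthogonal Vectors: V. Vassilevska Williams, IPEC 2015, §2.4, Conj. 4; Chen–Williams,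
  SODA 2019, §1.1; the underlying reduction CNF-SAT → OV is R. Williams, TCS 348 (2005), §5.1,
  Thm. 5) and its deterministic weakening `OVConjectureDet` — OPEN CONJECTURES, used only as
  hypotheses `(h : OVConjecture)`, `(h : OVConjectureDet)`, never discharged;
* **fine-grained.S10** the 3SUM conjecture `ThreeSUMConjecture` (Gajentaan–Overmars, CGTA 1995;
  Pătraşcu, STOC 2010);
* **fine-grained.S11** the APSP conjecture `APSPConjecture` (Vassilevska Williams–Williams,
  FOCS 2010 / J. ACM 65 (2018); VVW ICM 2018, §4);
* **fine-grained.S13** fine-grained reductions (VVW ICM 2018, Def. 2.1 and the remark following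
  it): `fgReducible_iff` and the transfer property `trulySubTime_of_fgReducible_of_sizeFitsWord`
  (proved, `trulySubTime_of_fgReducible_of_sizeFitsWord_holds`);
* **fine-grained.S12** subcubic equivalence of APSP with Negative Triangle, `(min,+)`-product and
  Radius (VW–W, J. ACM 65 (2018), Thm. 1.1; Abboud–Grandoni–Vassilevska Williams, SODA 2015);
* **fine-grained.S17** the `k`-SUM conjecture `KSUMConjecture` and
  "`k`-SUM in `n^{o(k)}` refutes ETH" (Pătraşcu–Williams, SODA 2010; Abboud–Lewi, ICALP 2013).

## Mathlib

Mathlib has no RAM model, no fine-grained reducibility and none of these conjectures (searched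
`OrthogonalVectors`, `threeSum`, `APSP`, `FineGrained`, `WordRAM`: no hits); used from Mathlib:
`Real.rpow`, `Nat.floor`/`Nat.ceil` (`⌊·⌋₊`, `⌈·⌉₊`), `Filter.Tendsto`, `Filter.atTop`, `nhds`.

## Design choices

* Conjectures are `def … : Prop` (never asserted). Randomised hypotheses (OV, 3SUM, `k`-SUM, as
  in VVW ICM 2018, §3) use `FGProblem.RandInTimeO` (success probability `≥ 2/3`); the APSP
  hypothesis is stated deterministically (`APSPConjecture`, the FOCS 2010 wording) with the
  randomised ICM 2018 wording as `APSPConjectureRand`; the implications between the variants are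
  proved (`InTimeO.randInTimeO`).
* `APSPConjecture` reads `∀ ε > 0, ∃ c, ¬ (APSP c).InTimeO (n ^ (3 - ε))`: VVW ICM 2018, §4 says
  "… with edge weights in `{-n^c, …, n^c}` and no negative cycles, *for large enough* `c`". Since
  the instance set of `APSP c` grows with `c` (weights bounded by `n ^ c`), non-existence of an
  algorithm is monotone in `c`, so "for large enough `c`" and "for some `c`" agree; the version with
  `c` fixed is `APSPConjectureFor c`.
* VW–W J. ACM 2018, Thm. 1.1 is about graphs with weights in `[-M, M]` and calls an algorithm truly
  subcubic if it runs in `O(n^{3-δ} · poly(log M))`. Their reductions change the weight range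
  polynomially (e.g. APSP → `(min,+)`-product produces entries up to `n · M`), so with the zoo's
  fixed ranges `[-n^c, n^c]` the faithful statement is an equivalence of the *families*
  `c ↦ APSP c`, `c ↦ NegativeTriangle c`: `SubcubicEquivalentFamily A B` asks, for every `c`, for
  a subcubic fine-grained reduction from `A c` to some `B c'` and from `B c` to some `A c'`. Its
  consequence `SubcubicEquivalentFamily.trulySubTime_iff_of_sizeFitsWord` ("either both families
  have truly subcubic algorithms for every weight exponent, or neither does") is exactly the
  wording of Thm. 1.1 and is proved here from the prelude's corrected transfer property
  `FGReducible.trulySubTime_of_sizeFitsWord` (VVW ICM 2018, the remark following Def. 2.1;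
  interim locator "Prop. 2.1"), under the prelude's well-formedness hypotheses
  `FGProblem.IsStandard` and `FGProblem.SizeFitsWord` (which the transfer needs in the word-RAM
  model, see the *Correction* bullet); unconditionally
  `SubcubicEquivalentFamily.trulySubTime_iff_of_sizeFitsWord_holds`. The instance
  `trulySubTime_APSP_iff_negativeTriangle` is the printed theorem for APSP and Negative Triangle
  (a named fact here; discharged downstream, in
  `Literature.Computability.FineGrained.MinPlusToNegativeTriangleSweepProofs`, from the two
  verified word-RAM reductions and the well-formedness theorems `APSP_isStandard`,
  `NegativeTriangle_isStandard` of `Literature.Computability.FineGrained.SubcubicEquivalencesAPSP`).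
* "For large enough `c`" ⇔ `∃ c` in `APSPConjecture` is made checkable: `APSP_inTimeO_anti`
  (instance sets of `APSP c` are nested, `inTimeO_restrict_anti`) and
  `apspConjecture_iff_eventually`.
* `KSUMConjecture k` has exponent `⌈k/2⌉` computed as `⌈(k : ℝ) / 2⌉₊` (with `k : ℕ`, `k / 2`
  would be floor division).
* `not_eth_of_kSUM_subpoly` renders "`k`-SUM in time `n^{o(k)}` for all `k`" as the existence of an
  exponent function `g : ℕ → ℝ` with `g k / k → 0` and `(kSUM k).InTimeO (n ^ g k)` for all
  `k ≥ 3` (Pătraşcu–Williams, SODA 2010, Cor. 5.1 wording: "`n^{o(k)}` for all `k`"); `ETH` is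
  Wave0's `Literature.Computability.FineGrained.ETH`.
* Correction and retired facts (see `Literature.Computability.Cryptography.FGComplexity`,
  section *Size measures that fit in a word*): the transfer property as first transcribed in this
  file — until 2026-08-15 the named fact `trulySubTime_of_fgReducible` (verbatim the prelude's
  since-retired `FGReducible.trulySubTime`: budgets `n^α`, `n^β`, hypotheses `IsStandard` only)
  and its family consequence, the named fact `SubcubicEquivalentFamily.trulySubTime_iff` (the
  Thm. 1.1 pattern for *arbitrary* subcubically equivalent families of well-formed problems) —
  omitted print's implicit hypothesis that the size measure `n` fits in `O(1)` machine words
  (automatic in print, where `n` is the input length, VVW ICM 2018, §1; VW–W, §3, Prop. 2 is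
  about "computational problems on `n × n` matrices", p. 27:11) and is FALSE in the word-RAM model
  (`WordRAM.step` stores oracle-answer lengths unreduced, so a tiny-word reduction can drive a
  diagonal computation through the answer lengths of the linear-time oracle problem of a universal
  program): kernel-checked refutations
  `trulySubTime_of_fgReducible_false` (the prelude's `FGReducible.trulySubTime_false`) and
  `SubcubicEquivalentFamily.trulySubTime_iff_false` in
  `Literature.Computability.FineGrained.ConjecturesProofs`, which state the refuted propositions
  inlined. A refuted named fact can never be discharged, so both defs were retired from this file
  (verdict clean-up 2026-08-15): `trulySubTime_of_fgReducible` is deleted — its corrected form is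
  the named fact `trulySubTime_of_fgReducible_of_sizeFitsWord` (S13 below, extra hypothesis
  `A.SizeFitsWord`; **proved**, `trulySubTime_of_fgReducible_of_sizeFitsWord_holds`) — and the
  name `SubcubicEquivalentFamily.trulySubTime_iff` survives only as a deprecated alias (end of the
  file) of the corrected theorem `SubcubicEquivalentFamily.trulySubTime_iff_of_sizeFitsWord_holds`. The
  corrected statements carry `FGProblem.SizeFitsWord` hypotheses, which the zoo problems satisfy
  (`APSP_sizeFitsWord`, `NegativeTriangle_sizeFitsWord`, …), so the APSP ⟺ Negative Triangle
  consequence is unaffected (`trulySubTime_APSP_iff_negativeTriangle_of_isStandard_of_sizeFitsWord`,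
  `trulySubTime_APSP_iff_negativeTriangle_of_isStandard_of_subcubicEquivalent`).
-/

namespace Literature.Computability.FineGrained

open Filter Topology Cryptography Cryptography.WordRAM

/-! ### fine-grained.S07: the word RAM -/

/-- **fine-grained.S07** (word RAM, definition home; Fredman–Willard, JCSS 47 (1993);
V. Vassilevska Williams ICM 2018, §2.) `P` is solvable in time `T(n)` iff there is a deterministic
word-RAM program `M` (unit-cost arithmetic, bitwise and indirect-addressing operations on `w`-bit
words) and a constant `k` such that, run with word size `w = k · inputWidth (encode a)`
(i.e. `Θ(log n)`-bit words) and without oracle or random coins, `M` outputs an accepted answer on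
every instance `a` within `⌊T (size a)⌋₊` steps. Randomised RAMs: `randInTime_iff`.
[cite: VassilevskaWilliamsICM2018, §2] -/
theorem inTime_iff (P : FGProblem) (T : ℕ → ℝ) :
    P.InTime T ↔ ∃ (M : Program) (k : ℕ), M.IsDeterministic ∧ M.IsOracleFree ∧
      ∀ a, ∃ out ∈ P.Good a, OutputsWithin M (k * inputWidth (P.encode a)) noOracle zeroCoins
        (P.encode a) out ⌊T (P.size a)⌋₊ :=
  Iff.rfl

/-- **fine-grained.S07** (randomised word RAM; V. Vassilevska Williams ICM 2018, §2.) `P` is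
solvable by a randomised algorithm in time `T(n)` iff there is an oracle-free word-RAM program `M`
(which may execute `rand`, loading a uniformly random `w`-bit word) and a constant `k` such that,
with word size `w = k · inputWidth (encode a)`, on every instance `a` the probability over the coin
words that `M` outputs an accepted answer within `⌊T (size a)⌋₊` steps is at least `2/3`.
[cite: VassilevskaWilliamsICM2018, §2] -/
theorem randInTime_iff (P : FGProblem) (T : ℕ → ℝ) :
    P.RandInTime T ↔ ∃ (M : Program) (k : ℕ), M.IsOracleFree ∧
      ∀ a, (2 / 3 : ℝ) ≤ successProb M (k * inputWidth (P.encode a)) noOracle (P.encode a)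
        (P.Good a) ⌊T (P.size a)⌋₊ :=
  Iff.rfl

/-! ### fine-grained.S08: the OV conjecture -/

/-- **fine-grained.S08** The Orthogonal Vectors conjecture (OVC), randomised form: for every
`ε > 0` there is `c ≥ 1` such that OV on `n` vectors of dimension `d = c log n` (`OVWithDim c`,
`d = c ⌊log₂ n⌋`; `1 ≤ c` only excludes the junk regime `c = 0`) has no randomised
`O(n^{2-ε})`-time word-RAM algorithm (success probability `≥ 2/3`, `FGProblem.RandInTimeO`).
An OPEN CONJECTURE (a hardness hypothesis) [status: open]: it is used only as a hypothesis
`(h : OVConjecture)`, is not a published theorem and has no discharge (a proof would be an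
unconditional `n^{2-o(1)}`-type time lower bound on the word RAM for a problem of input length
`O(n log n)`); its weakening to deterministic algorithms `OVConjectureDet`
(`ovConjectureDet_of_ovConjecture_holds`) is the conclusion of fine-grained.S09 (word-RAM SETH
implies it, `ovConjectureDet_of_sethWordRAM`). Relation to print: the quantifier shape `∀ ε ∃ c`
over dimensions `c log n` is the wording of Chen–Williams, SODA 2019 (arXiv:1811.12017), §1.1:
"we say `Π` is in truly subquadratic time if there is an `ε > 0` such that for all constant `c`,
`Π` is solvable in `O(n^{2-ε})` time on `n` vectors in `c log n` dimensions. Note the Orthogonal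
Vectors Conjecture (OVC) is equivalent to saying 'OV is not in truly subquadratic time.'"; the
word-RAM, randomised wording is V. Vassilevska Williams, IPEC 2015, §2.4, Conj. 4 (OVC): "In the
Word RAM model with `O(log n)` bit words, any algorithm requires `n^{2-o(1)}` time in expectation
to determine whether a set of `n` vectors over `{0,1}^d` for `d = ω(log n)` contains an orthogonal
pair" (randomised algorithms also in VVW ICM 2018, §3, Hypothesis 2, the locator of `OVWithDim`;
an algorithm with expected running time `T` yields one succeeding with probability `≥ 2/3`
within `3T` steps by Markov's inequality, so for the same dimension regime the non-existence
statement here is at least as strong as print's "in expectation"; "with high probability" and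
`2/3` agree up to `O(log n)` repetitions, absorbed by `ε`); Bringmann, STACS 2019, §2: "It is
conjectured that Orthogonal Vectors has no `O(n^{2-δ} d^c)`-time algorithm for any `δ, c > 0`"
is the `poly(d)` form (hypothesis OVH, `OVHWordRAM` of
`Literature.Computability.FineGrained.EditDistanceSETH`, implied by the `c log n` form:
`ovhWordRAM_of_ovConjectureDet`). The underlying reduction CNF-SAT → OV is R. Williams, TCS 348
(2005), §5.1, Thm. 5. (Locator corrected 2026-08-15: the earlier locator pointed at
Abboud–Vassilevska Williams–Weimann, ICALP 2014, §1, which states the 3-SUM conjecture (Conj. 1)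
and SETH (Conj. 2) but no OV conjecture; statement unchanged.)
[cite: VassilevskaWilliamsIPEC2015, §2.4 Conjecture 4] -/
@[conjecture] def OVConjecture : Prop :=
  ∀ ε : ℝ, 0 < ε → ∃ c : ℕ, 1 ≤ c ∧ ¬ (OVWithDim c).RandInTimeO fun n => (n : ℝ) ^ (2 - ε)

/-- **fine-grained.S08** The deterministic OV conjecture: for every `ε > 0` there is `c ≥ 1` such
that OV with `d = c log n` (`OVWithDim c`) has no deterministic `O(n^{2-ε})`-time word-RAM
algorithm (`FGProblem.InTimeO`). The weakening of `OVConjecture` to deterministic algorithms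
(`ovConjectureDet_of_ovConjecture_holds`), and the form implied by word-RAM SETH through
R. Williams' split-and-list reduction CNF-SAT → OV (TCS 348 (2005), §5.1, Thm. 5: if cooperative
subset queries on databases of `k` subsets of a universe of size `d` are solvable in time
`Õ(f(d) k^{2-ε})`, then CNF-SAT on `n` variables and `m` clauses is in time
`Õ(f(m) 2^{(1-ε/2)n})`; with sparsification V. Vassilevska Williams, IPEC 2015, §4, Thm. 7,
"`k`-SAT `≤_{2ⁿ,n²}` OV"; in this tree fine-grained.S09, the named fact
`ovConjectureDet_of_sethWordRAM` of `Literature.Computability.FineGrained.SETHHardness`). An OPEN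
CONJECTURE [status: open]: used only as a hypothesis `(h : OVConjectureDet)` (as in `Sweep1`,
`EditDistanceSETH`) or as a conclusion (fine-grained.S09, `OVFromSETH`), never asserted; it is
not a published theorem and there is nothing to discharge. Printed wordings and their relation to
this `∀ ε ∃ c` rendering: see `OVConjecture`; Chen–Williams, SODA 2019, §1.1 prints the
`c log n`, `∀ ε ∃ c` shape ("OV is not in truly subquadratic time").
[cite: ChenWilliams2019, §1.1] -/
@[conjecture] def OVConjectureDet : Prop :=
  ∀ ε : ℝ, 0 < ε → ∃ c : ℕ, 1 ≤ c ∧ ¬ (OVWithDim c).InTimeO fun n => (n : ℝ) ^ (2 - ε)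

/-- The randomised OV conjecture implies the deterministic one (a deterministic algorithm is a
randomised one). VVW ICM 2018, §3. [cite: VassilevskaWilliamsICM2018, §3] -/
def ovConjectureDet_of_ovConjecture : Prop :=
  ∀ (h : OVConjecture),
    OVConjectureDet

/- interim proof relied on results that are now named facts (D-0014); demoted to a fact by the M5
import, proof preserved:
:= by
  intro ε hε
  obtain ⟨c, hc, hnot⟩ := h ε hε
  exact ⟨c, hc, fun hdet => hnot hdet.randInTimeO⟩
-/

/-! ### fine-grained.S10: the 3SUM conjecture -/

/-- **fine-grained.S10** The 3SUM conjecture (open; Gajentaan–Overmars, CGTA 5 (1995);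
Pătraşcu, STOC 2010; VVW ICM 2018, §3, Hypothesis 3): 3SUM on `n` integers in `{-n³, …, n³}` has
no randomised `O(n^{2-ε})`-time algorithm for any `ε > 0`. [cite: Patrascu2010, §1] -/
@[conjecture] def ThreeSUMConjecture : Prop :=
  ∀ ε : ℝ, 0 < ε → ¬ threeSUM.RandInTimeO fun n => (n : ℝ) ^ (2 - ε)

/-- The deterministic 3SUM conjecture (Gajentaan–Overmars, CGTA 5 (1995)): no deterministic
`O(n^{2-ε})`-time algorithm for 3SUM. [folklore] -/
@[conjecture] def ThreeSUMConjectureDet : Prop :=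
  ∀ ε : ℝ, 0 < ε → ¬ threeSUM.InTimeO fun n => (n : ℝ) ^ (2 - ε)

/-- The randomised 3SUM conjecture implies the deterministic one. [folklore] -/
def threeSUMConjectureDet_of_threeSUMConjecture : Prop :=
  ∀ (h : ThreeSUMConjecture),
    ThreeSUMConjectureDet

/- interim proof relied on results that are now named facts (D-0014); demoted to a fact by the M5
import, proof preserved:
:=
  fun ε hε hdet => h ε hε hdet.randInTimeO
-/

/-! ### fine-grained.S11: the APSP conjecture -/

/-- **fine-grained.S11** The APSP conjecture for a fixed weight exponent `c`
(Vassilevska Williams–Williams, FOCS 2010 / J. ACM 65 (2018), §1): APSP on `n`-node graphs with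
integer edge weights in `{-n^c, …, n^c}` (and no negative cycles) has no deterministic
`O(n^{3-ε})`-time algorithm for any `ε > 0`. A HARDNESS HYPOTHESIS, never asserted
[status: open]: for each fixed `c ≥ 1` it is an open problem at least as strong as
`APSPConjecture` (`apspConjecture_of_apspConjectureFor`; monotone in `c`,
`APSPConjectureFor.mono`), used only as a hypothesis `(h : APSPConjectureFor c)`; it has no
discharge. Do not instantiate it at `c = 0` (weights in `{-1, 0, 1}`): for small weights print
has truly subcubic algorithms via fast matrix multiplication — the source, §2, p. 27:8: "an
`Õ(M n^ω)` algorithm where `M` is the largest weight in the matrices, due to Alon, Galil, and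
Margalit … can only be used to efficiently solve APSP in special cases such as when the weights
in the graph are small [56, 77]" ([77] = U. Zwick, J. ACM 49 (2002) 289–317, `Õ(n^{2.575})` for
directed graphs with weights in `{-1, 0, 1}`) — so `APSPConjectureFor 0` is presumably false
(not refuted in-tree: that needs fast matrix multiplication on the word RAM), which is why print
asks for "large enough `c`" (VVW ICM 2018, §4, Hypothesis 4).
[cite: VassilevskaWilliamsWilliams2018, §1] -/
def APSPConjectureFor (c : ℕ) : Prop :=
  ∀ ε : ℝ, 0 < ε → ¬ (APSP c).InTimeO fun n => (n : ℝ) ^ (3 - ε)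

/-- **fine-grained.S11** The APSP conjecture (open; Vassilevska Williams–Williams, FOCS 2010 /
J. ACM 65 (2018); VVW ICM 2018, §4, Hypothesis 4): for every `ε > 0`, for large enough `c` there
is no `O(n^{3-ε})`-time algorithm for APSP on `n`-node graphs with weights in `{-n^c, …, n^c}`.
As the instance sets of `APSP c` increase with `c`, "for large enough `c`" is rendered as `∃ c`
(see the module docstring). Deterministic form; the randomised form is `APSPConjectureRand`.
An OPEN CONJECTURE (a hardness hypothesis) [status: open]: it is used only as a hypothesis
`(h : APSPConjecture)`, is not a published theorem and has no discharge. The cited source poses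
it as open and uses it only conditionally — J. ACM 65 (2018), §1, p. 27:2: "One of the 'Holy
Grails' of graph algorithms is to determine whether this cubic complexity is basically inherent,
or whether a significant improvement (say, `O(n^{2.9})` time) is possible"; abstract, p. 27:1:
"if APSP cannot be solved in `n^{3-ε}` time for any `ε > 0`, then many other problems also need
essentially cubic time"; §9, open question (3), p. 27:35: "Is there a truly subcubic algorithm
for minimum edge-weight triangle? … it is equivalent to asking for a variety of subcubic
algorithms for several fundamental path problems" — its theorems (Thm. 1.1) are subcubic
*equivalences* (fine-grained.S12), not lower bounds. What is provable unconditionally is in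
`Literature.Computability.FineGrained.ConjecturesAPSPProofs`: the regime `ε > 1` holds by output
size (`apspConjecture_restricted_one_lt`, from `APSP_not_inTimeO_rpow_of_lt_two`), and
`apspConjecture_iff_le_one` reduces `APSPConjecture` to the regime `0 < ε ≤ 1`; there a proof
would be an unconditional superlinear time lower bound (time `O(N^{(3-ε)/2})` does not suffice,
`N = n² + 1` the input length) for an explicitly given polynomial-time function on the unit-cost
word RAM with `Θ(log n)`-bit words — no such bound is known — and a refutation would be a truly
subcubic APSP algorithm (best known: `n³ / 2^{Θ(√(log n))}`, R. Williams, STOC 2014, randomised;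
Chan–Williams, SODA 2016, deterministic; refs. [71], [18] of the source, pp. 27:2, 27:8). The
statement is not vacuous: cubic time is attained in-tree by Floyd–Warshall on the word RAM
(`Literature.Computability.Cryptography.APSP_inTimeO_cube_holds`).
[cite: VassilevskaWilliamsWilliams2018, §1] -/
@[conjecture] def APSPConjecture : Prop :=
  ∀ ε : ℝ, 0 < ε → ∃ c : ℕ, ¬ (APSP c).InTimeO fun n => (n : ℝ) ^ (3 - ε)

/-- The randomised APSP conjecture (VVW ICM 2018, §4, Hypothesis 4, verbatim: "no randomized
algorithm can solve APSP in `O(n^{3-ε})` time for `ε > 0` … for large enough `c`").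
An OPEN CONJECTURE (a hardness hypothesis) [status: open]: print's "Hypothesis 4", used only as a
hypothesis `(h : APSPConjectureRand)`, not a published theorem, no discharge; it implies the
deterministic form (`apspConjecture_of_apspConjectureRand`), so it is at least as strong as the
open `APSPConjecture` (see there). [cite: VassilevskaWilliamsICM2018, §4 Hypothesis 4] -/
@[conjecture] def APSPConjectureRand : Prop :=
  ∀ ε : ℝ, 0 < ε → ∃ c : ℕ, ¬ (APSP c).RandInTimeO fun n => (n : ℝ) ^ (3 - ε)

/-- The randomised APSP conjecture implies the deterministic one. [folklore] -/
def apspConjecture_of_apspConjectureRand : Prop :=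
  ∀ (h : APSPConjectureRand),
    APSPConjecture

/- interim proof relied on results that are now named facts (D-0014); demoted to a fact by the M5
import, proof preserved:
:= by
  intro ε hε
  obtain ⟨c, hnot⟩ := h ε hε
  exact ⟨c, fun hdet => hnot hdet.randInTimeO⟩
-/

/-- The APSP conjecture for some fixed exponent `c` (uniformly in `ε`) implies the APSP
conjecture. [folklore] -/
theorem apspConjecture_of_apspConjectureFor {c : ℕ} (h : APSPConjectureFor c) : APSPConjecture :=
  fun ε hε => ⟨c, h ε hε⟩

/-- Running-time bounds descend along inclusions of instance sets: an algorithm for `P`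
restricted to `S'` is an algorithm for `P` restricted to `S ⊆ S'` (same encoding, size, accepted
outputs). [folklore] -/
theorem inTimeO_restrict_anti {P : FGProblem} {S S' : Set P.Inst} (hSS' : S ⊆ S') {t : ℕ → ℝ}
    (h : (P.restrict S').InTimeO t) : (P.restrict S).InTimeO t := by
  obtain ⟨C, M, k, hd, ho, hM⟩ := h
  exact ⟨C, M, k, hd, ho, fun a => hM ⟨a.1, hSS' a.2⟩⟩

/-- Randomised running-time bounds descend along inclusions of instance sets. [folklore] -/
theorem randInTimeO_restrict_anti {P : FGProblem} {S S' : Set P.Inst} (hSS' : S ⊆ S')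
    {t : ℕ → ℝ} (h : (P.restrict S').RandInTimeO t) : (P.restrict S).RandInTimeO t := by
  obtain ⟨C, M, k, ho, hM⟩ := h
  exact ⟨C, M, k, ho, fun a => hM ⟨a.1, hSS' a.2⟩⟩

/-- The instance sets of `APSP c` increase with `c` (weights bounded by `n ^ c ≤ n ^ c'`; for
`n = 0` the matrix is empty). [folklore] -/
theorem APSP_instances_mono {c c' : ℕ} (hcc' : c ≤ c') :
    {W : Σ n, Matrix (Fin n) (Fin n) (WithTop ℤ) |
        HasBoundedWeights W.2 (W.1 ^ c) ∧ HasNoNegativeCycle W.2} ⊆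
      {W : Σ n, Matrix (Fin n) (Fin n) (WithTop ℤ) |
        HasBoundedWeights W.2 (W.1 ^ c') ∧ HasNoNegativeCycle W.2} := by
  rintro ⟨n, W⟩ ⟨hb, hn⟩
  refine ⟨fun i j => ?_, hn⟩
  rcases hb i j with h | ⟨z, hz, hzle⟩
  · exact Or.inl h
  · refine Or.inr ⟨z, hz, hzle.trans ?_⟩
    rcases Nat.eq_zero_or_pos n with rfl | hn0
    · exact (Fin.elim0 i)
    · exact_mod_cast Nat.pow_le_pow_right hn0 hcc'

/-- An `O(t)`-time algorithm for `APSP c'` is one for `APSP c` when `c ≤ c'`; hence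
non-existence of algorithms is monotone in the weight exponent, justifying the rendering of
"for large enough `c`" as `∃ c` in `APSPConjecture` (VVW ICM 2018, §4).
[cite: VassilevskaWilliamsICM2018, §4] -/
theorem APSP_inTimeO_anti {c c' : ℕ} (hcc' : c ≤ c') {t : ℕ → ℝ} (h : (APSP c').InTimeO t) :
    (APSP c).InTimeO t :=
  inTimeO_restrict_anti (APSP_instances_mono hcc') h

/-- `APSPConjectureFor` is monotone in the weight exponent. [folklore] -/
theorem APSPConjectureFor.mono {c c' : ℕ} (hcc' : c ≤ c') (h : APSPConjectureFor c) :
    APSPConjectureFor c' :=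
  fun ε hε h' => h ε hε (APSP_inTimeO_anti hcc' h')

/-- The APSP conjecture is equivalent to its "for all large enough `c`" wording
(VVW ICM 2018, §4, Hypothesis 4). [cite: VassilevskaWilliamsICM2018, §4 Hypothesis 4] -/
theorem apspConjecture_iff_eventually :
    APSPConjecture ↔
      ∀ ε : ℝ, 0 < ε → ∀ᶠ c in atTop, ¬ (APSP c).InTimeO fun n => (n : ℝ) ^ (3 - ε) := by
  refine forall₂_congr fun ε _ => ⟨fun ⟨c, hc⟩ => ?_, fun h => h.exists⟩
  exact eventually_atTop.2 ⟨c, fun c' hcc' h' => hc (APSP_inTimeO_anti hcc' h')⟩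

/-! ### fine-grained.S13: fine-grained reductions -/

/-- **fine-grained.S13** Fine-grained reductions (definition home; V. Vassilevska Williams
ICM 2018, Def. 2.1, verbatim). Let `A`, `B` be problems with time bounds `a`, `b`. Then `(A, a)`
is *fine-grained reducible* to `(B, b)` iff for every `ε > 0` there are `δ > 0`, a deterministic
word-RAM program `M` with oracle access to `B` (word size `k · inputWidth`), and a constant `C`,
such that for every oracle `O` answering `B` correctly and every instance `x` of `A` of size `n`,
`M` halts within `⌊C a(n)^{1-δ} + C⌋₊` steps with an accepted answer for `x`, its oracle queries
are (encodings of) `B`-instances `y₁, …, y_q`, `∑ᵢ b(|yᵢ|)^{1-ε} ≤ C a(n)^{1-δ} + C`, and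
(the prelude's explicit charge for *writing* the queries, implicit in loc. cit. where a query of
length `L` costs `L` time) the total query length `∑ᵢ |encode yᵢ|` is at most
`C a(n)^{1-δ} + C`. [cite: VassilevskaWilliamsICM2018, Def. 2.1] -/
theorem fgReducible_iff (A : FGProblem) (a : ℕ → ℝ) (B : FGProblem) (b : ℕ → ℝ) :
    FGReducible A a B b ↔
      ∀ ε : ℝ, 0 < ε → ∃ δ : ℝ, 0 < δ ∧ ∃ (M : Program) (k : ℕ) (C : ℝ), M.IsDeterministic ∧
        ∀ O : List ℕ → List ℕ, B.OracleAnswers O → ∀ x : A.Inst, ∃ (c : Cfg) (bs : List B.Inst),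
          HaltsWithin M (k * inputWidth (A.encode x)) O zeroCoins (A.encode x)
              ⌊C * a (A.size x) ^ (1 - δ) + C⌋₊ c ∧
            readOut c.mem ∈ A.Good x ∧
            c.queries = bs.map B.encode ∧
            (bs.map fun y => b (B.size y) ^ (1 - ε)).sum ≤ C * a (A.size x) ^ (1 - δ) + C ∧
            ((bs.map fun y => (B.encode y).length).sum : ℝ) ≤ C * a (A.size x) ^ (1 - δ) + C :=
  Iff.rfl

/-! #### Retired: the uncorrected transfer property `trulySubTime_of_fgReducible`

The defining (transfer) property of fine-grained reductions — VVW ICM 2018, §2.2, the remark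
following Def. 2.1 (interim locator "Prop. 2.1"): if `(A, n^α) ≤_FG (B, n^β)` and `B` is
solvable in time `O(n^{β-ε})` for some `ε > 0`, then `A` is solvable in time `O(n^{α-ε'})` for
some `ε' > 0` — is vendored below as the named fact `trulySubTime_of_fgReducible_of_sizeFitsWord`
(section *fine-grained.S13 / S12 corrected for the word-RAM model*; proved,
`trulySubTime_of_fgReducible_of_sizeFitsWord_holds`). Until 2026-08-15 this section also carried
its first transcription `trulySubTime_of_fgReducible` (hypotheses `IsStandard` only, no
`A.SizeFitsWord` — print's "inputs of length `n`", `O(log n)`-bit words), which is FALSE in the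
word-RAM model: `trulySubTime_of_fgReducible_false` in
`Literature.Computability.FineGrained.ConjecturesProofs` (the refuted proposition inlined; it is
the prelude's `FGReducible.trulySubTime_false` of
`Literature.Computability.Cryptography.FGComplexityRefutation`). A refuted named fact can never
be discharged; the def was retired (deleted) by the verdict clean-up, see the module docstring,
*Correction and retired facts*. -/

/-! ### fine-grained.S12: subcubic equivalences (VW–W 2018) -/

/-- **Subcubic equivalence of weight-parametrised families** (VW–W, J. ACM 65 (2018), Thm. 1.1,
for problems on graphs/matrices with entries in `[-n^c, n^c]`): for every weight exponent `c`
there is a subcubic fine-grained reduction (both budgets `n ^ 3`, as in the prelude's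
`SubcubicEquivalent`) from `A c` to `B c'` for some `c'`, and from `B c` to `A c'` for some `c'`.
The exponent may grow because the reductions of VW–W enlarge the weight range polynomially
(e.g. entries up to `n · M` in APSP → `(min,+)`-product). [folklore] -/
def SubcubicEquivalentFamily (A B : ℕ → FGProblem) : Prop :=
  (∀ c : ℕ, ∃ c' : ℕ,
      FGReducible (A c) (fun n => (n : ℝ) ^ (3 : ℝ)) (B c') (fun n => (n : ℝ) ^ (3 : ℝ))) ∧
    ∀ c : ℕ, ∃ c' : ℕ,
      FGReducible (B c) (fun n => (n : ℝ) ^ (3 : ℝ)) (A c') (fun n => (n : ℝ) ^ (3 : ℝ))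

/-- Subcubic equivalence of families is symmetric. [folklore] -/
theorem SubcubicEquivalentFamily.symm {A B : ℕ → FGProblem} (h : SubcubicEquivalentFamily A B) :
    SubcubicEquivalentFamily B A :=
  ⟨h.2, h.1⟩

/-- A subcubic equivalence of two fixed problems is a subcubic equivalence of the constant
families. [folklore] -/
theorem SubcubicEquivalentFamily.of_subcubicEquivalent {A B : FGProblem}
    (h : SubcubicEquivalent A B) : SubcubicEquivalentFamily (fun _ => A) fun _ => B :=
  ⟨fun c => ⟨c, h.1⟩, fun c => ⟨c, h.2⟩⟩

/-! #### Retired: the uncorrected family transfer `SubcubicEquivalentFamily.trulySubTime_iff`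

The content of a subcubic equivalence of families of well-formed problems (VW–W, J. ACM 65
(2018), Thm. 1.1: "either all of them have truly subcubic algorithms, or none of them do"; §3,
Prop. 2 with Def. 3.1, both ways) — `A c` is truly subcubic for every weight exponent `c` iff
`B c` is — is the theorem `SubcubicEquivalentFamily.trulySubTime_iff_of_sizeFitsWord` below
(section *fine-grained.S13 / S12 corrected for the word-RAM model*; unconditionally
`SubcubicEquivalentFamily.trulySubTime_iff_of_sizeFitsWord_holds`), for families whose size
measures fit in a word. Until 2026-08-15 this section carried its first transcription as the
named fact `SubcubicEquivalentFamily.trulySubTime_iff` (hypotheses `IsStandard` only, for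
*arbitrary* families), derived from the uncorrected transfer property and FALSE in the word-RAM
model: `SubcubicEquivalentFamily.trulySubTime_iff_false` in
`Literature.Computability.FineGrained.ConjecturesProofs` (the refuted proposition inlined; constant
families of the counterexample `univAPow 3 ≡₃ univB` of
`Literature.Computability.Cryptography.FGComplexityRefutation`). The def was retired by the verdict
clean-up; the name is re-declared at the end of this file as a deprecated alias of the corrected
theorem, see the module docstring, *Correction and retired facts*. -/

/-- **fine-grained.S12** (Vassilevska Williams–Williams, J. ACM 65 (2018), Thm. 1.1.) APSP and
Negative Triangle (on `n`-node graphs with weights in `[-n^c, n^c]`) are subcubically equivalent: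
each reduces to the other by a subcubic fine-grained reduction, up to a polynomial change of the
weight range. [cite: VassilevskaWilliamsWilliams2018, Thm. 1.1] -/
def subcubicEquivalent_APSP_negativeTriangle : Prop :=
  SubcubicEquivalentFamily APSP NegativeTriangle

/-- **fine-grained.S12** (Vassilevska Williams–Williams, J. ACM 65 (2018), Thm. 1.1; the
equivalence APSP ≡ distance product goes back to Fischer–Meyer 1971 / Aho–Hopcroft–Ullman 1974.)
APSP and the `(min,+)`-product of `n × n` matrices with entries in `[-n^c, n^c]` are subcubically
equivalent, up to a polynomial change of the weight range.
[cite: VassilevskaWilliamsWilliams2018, Thm. 1.1] -/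
def subcubicEquivalent_APSP_minPlusProduct : Prop :=
  SubcubicEquivalentFamily APSP MinPlusProduct

/-- **fine-grained.S12** (Abboud–Grandoni–Vassilevska Williams, SODA 2015, Thm. 1.1; listed with
VW–W, J. ACM 65 (2018), Thm. 1.1 in VVW ICM 2018, §4.) APSP and Radius of weighted digraphs with
weights in `[-n^c, n^c]` are subcubically equivalent, up to a polynomial change of the weight
range. [cite: AbboudGrandoniVassilevskaWilliams2015, Thm. 1.1] -/
def subcubicEquivalent_APSP_radius : Prop :=
  SubcubicEquivalentFamily APSP Radius

/-- **fine-grained.S12** (VW–W, J. ACM 65 (2018), Thm. 1.1, verbatim consequence: "either all of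
them have truly subcubic algorithms, or none of them do".) APSP with polynomially bounded weights
is truly subcubic for every weight exponent iff Negative Triangle is. This follows from
`subcubicEquivalent_APSP_negativeTriangle` by
`SubcubicEquivalentFamily.trulySubTime_iff_of_sizeFitsWord_holds` once the (routine)
well-formedness facts `(APSP c).IsStandard (n ^ 3)`, `(NegativeTriangle c).IsStandard (n ^ 3)` are
recorded for the zoo problems (the word-size conditions `APSP_sizeFitsWord`,
`NegativeTriangle_sizeFitsWord` are proved below); see
`trulySubTime_APSP_iff_negativeTriangle_of_isStandard` and
`trulySubTime_APSP_iff_negativeTriangle_of_isStandard_of_subcubicEquivalent`. (Discharged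
downstream: `trulySubTime_APSP_iff_negativeTriangle_holds` in
`Literature.Computability.FineGrained.MinPlusToNegativeTriangleSweepProofs`.)
[cite: VassilevskaWilliamsWilliams2018, Thm. 1.1] -/
def trulySubTime_APSP_iff_negativeTriangle : Prop :=
  (∀ c, (APSP c).TrulySubTime 3) ↔ ∀ c, (NegativeTriangle c).TrulySubTime 3

/-- The conditional form of `trulySubTime_APSP_iff_negativeTriangle`, given well-formedness of
the two families for the budget `n ^ 3`: from `subcubicEquivalent_APSP_negativeTriangle` and the
transfer property of fine-grained reductions (VVW ICM 2018, §2.2, the remark following Def. 2.1;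
interim locator "Prop. 2.1"), in its corrected form — the word-size side conditions
`APSP_sizeFitsWord`, `NegativeTriangle_sizeFitsWord` are theorems, so the conditional statement is
unchanged by the correction
(`trulySubTime_APSP_iff_negativeTriangle_of_isStandard_of_subcubicEquivalent` below).
[cite: VassilevskaWilliamsICM2018, §2.2 Def. 2.1 and the remark following it] -/
def trulySubTime_APSP_iff_negativeTriangle_of_isStandard : Prop :=
  ∀ (hA : ∀ c, (APSP c).IsStandard fun n => (n : ℝ) ^ (3 : ℝ))
    (hN : ∀ c, (NegativeTriangle c).IsStandard fun n => (n : ℝ) ^ (3 : ℝ)),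
    (∀ c, (APSP c).TrulySubTime 3) ↔ ∀ c, (NegativeTriangle c).TrulySubTime 3

/- interim proof relied on results that are now named facts (D-0014); demoted to a fact by the M5
import, proof preserved (it applied the uncorrected, since retired family transfer
`SubcubicEquivalentFamily.trulySubTime_iff`; the working derivation is
`trulySubTime_APSP_iff_negativeTriangle_of_isStandard_of_subcubicEquivalent` below):
:=
  subcubicEquivalent_APSP_negativeTriangle.trulySubTime_iff hA hN
-/

/-! ### fine-grained.S17: the `k`-SUM conjecture -/

/-- **fine-grained.S17** The `k`-SUM conjecture (open; Pătraşcu–Williams, SODA 2010; Abboud–Lewi,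
ICALP 2013, §1, Conjecture 1; VVW ICM 2018, §3): `k`-SUM on `n` integers (in
`{-n^k, …, n^k}`) has no randomised `O(n^{⌈k/2⌉-ε})`-time algorithm for any `ε > 0`. The ceiling
is computed in `ℝ` (`⌈(k : ℝ) / 2⌉₊`). An OPEN CONJECTURE: it is used only as a hypothesis
`(h : KSUMConjecture k)`, is not a published theorem and has no discharge. Relation to print:
Abboud–Lewi state Conjecture 1 for every `k ≥ 2`, for randomised algorithms succeeding "with high
probability", over integers in `[-M, M]` with the input size measured as `n log M` (loc. cit.,
§2.1); here the success probability is `≥ 2/3` (`FGProblem.RandInTimeO`; equivalent by majority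
amplification, the `O(log n)` factor being absorbed by `ε`), the size is the number `n` of integers
and the entries are bounded by `n ^ k` — the bounded-universe normalisation of the zoo's `kSUM k`
(w.l.o.g. up to factors polylogarithmic in `n` and `log M`, by the random-prime range reduction
of Abboud–Lewi–Williams, ESA 2014, arXiv:1311.3054, Lemma 6.1), under which
`n log M = Θ(n log n)`; restricting the instances makes this non-existence statement a priori at
least as strong as print's for the same `k`. Small `k`: `KSUMConjecture 0` fails (junk: `kSUM 0`
accepts every instance, in constant time); for `k = 1, 2` the exponent `⌈k/2⌉` is `1` and the
statement merely asserts that `1`-SUM and `2`-SUM have no sublinear-time randomised algorithm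
(print's case `k = 2`; true by the standard unread-position adversary argument, not formalised
here). The
hypothesis used in the literature is `k ≥ 3` (`KSUMConjectureAll`; Abboud–Lewi, Thm. 2).
[cite: AbboudLewi2013, §1 Conjecture 1] -/
def KSUMConjecture (k : ℕ) : Prop :=
  ∀ ε : ℝ, 0 < ε → ¬ (kSUM k).RandInTimeO fun n => (n : ℝ) ^ ((⌈(k : ℝ) / 2⌉₊ : ℝ) - ε)

/-- The `k`-SUM conjecture as a single hypothesis (Abboud–Lewi, ICALP 2013, §1, Conjecture 1,
verbatim: "There does not exist a `k ≥ 2`, an `ε > 0`, and a randomized algorithm that succeeds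
(with high probability) in solving `k`-SUM in time `O(n^{⌈k/2⌉-ε})`"; VVW ICM 2018, §3):
`KSUMConjecture k` for every `k ≥ 3` (print's additional case `k = 2` is the trivial linear lower
bound, see `KSUMConjecture` for this and the other normalisations). An OPEN CONJECTURE — a
hypothesis `(h : KSUMConjectureAll)`, never a theorem; there is nothing to discharge. Its `k = 3`
instance is the 3SUM conjecture for the problem `kSUM 3` (`kSUMConjecture_three_iff`).
[cite: AbboudLewi2013, §1 Conjecture 1] -/
@[conjecture] def KSUMConjectureAll : Prop :=
  ∀ k : ℕ, 3 ≤ k → KSUMConjecture k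

/-- The `3`-SUM instance of the `k`-SUM conjecture has exponent `⌈3/2⌉ = 2`, i.e. it is the
statement of `ThreeSUMConjecture` for the problem `kSUM 3` (same instances and bound `n³` as
`threeSUM`, with `HasKSum 3` in place of `HasThreeSum`). [folklore] -/
theorem kSUMConjecture_three_iff :
    KSUMConjecture 3 ↔ ∀ ε : ℝ, 0 < ε → ¬ (kSUM 3).RandInTimeO fun n => (n : ℝ) ^ (2 - ε) := by
  have h : ((⌈(3 : ℕ) / (2 : ℝ)⌉₊ : ℕ) : ℝ) = 2 := by norm_num
  simp only [KSUMConjecture, Nat.cast_ofNat] at h ⊢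
  rw [h]

/-- **fine-grained.S17** (Pătraşcu–Williams, SODA 2010, Cor. 5.1; cf. Abboud–Lewi, ICALP 2013.)
If `k`-SUM on `n` numbers is solvable in time `n^{o(k)}` for all `k` — rendered as: there is an
exponent function `g` with `g(k)/k → 0` such that `k`-SUM is in time `O(n^{g(k)})` for every
`k ≥ 3` — then ETH fails. [cite: PatrascuWilliams2010, Cor. 5.1] -/
def not_eth_of_kSUM_subpoly : Prop :=
  ∀ (h : ∃ g : ℕ → ℝ, Tendsto (fun k => g k / k) atTop (𝓝 0) ∧
      ∀ k, 3 ≤ k → (kSUM k).InTimeO fun n => (n : ℝ) ^ g k),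
    ¬ ETH

/-! ### Randomised hypotheses imply the deterministic ones (discharged) -/

/-- Discharges `ovConjectureDet_of_ovConjecture`: the randomised OV conjecture implies the
deterministic one (a deterministic algorithm is a randomised one,
`FGProblem.InTimeO.randInTimeO_holds`). VVW ICM 2018, §3. [cite: VassilevskaWilliamsICM2018, §3] -/
theorem ovConjectureDet_of_ovConjecture_holds : ovConjectureDet_of_ovConjecture := by
  intro h ε hε
  obtain ⟨c, hc, hnot⟩ := h ε hε
  exact ⟨c, hc, fun hdet => hnot hdet.randInTimeO'⟩

/-- Discharges `threeSUMConjectureDet_of_threeSUMConjecture`. [folklore] -/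
theorem threeSUMConjectureDet_of_threeSUMConjecture_holds :
    threeSUMConjectureDet_of_threeSUMConjecture :=
  fun h ε hε hdet => h ε hε hdet.randInTimeO'

/-- Discharges `apspConjecture_of_apspConjectureRand`. [folklore] -/
theorem apspConjecture_of_apspConjectureRand_holds : apspConjecture_of_apspConjectureRand := by
  intro h ε hε
  obtain ⟨c, hnot⟩ := h ε hε
  exact ⟨c, fun hdet => hnot hdet.randInTimeO'⟩

/-! ### fine-grained.S13 / S12 corrected for the word-RAM model (size measures that fit in a word)

See the module docstring (Correction) and `Literature.Computability.Cryptography.FGComplexity`,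
section *Size measures that fit in a word*, for why the uncorrected transfer property is refutable
in the model and why the extra hypothesis `FGProblem.SizeFitsWord` is exactly print's convention
("inputs of length `n`", `O(log n)`-bit words). -/

/-- **fine-grained.S13** The defining property of fine-grained reductions, corrected transcription
(V. Vassilevska Williams ICM 2018, Def. 2.1 and the remark following it: "the definition implies
that if `A` is `(a, b)`-reducible to `B` and `B` has a `b(n)^{1-ε}` time algorithm then `A` has an
`a(n)^{1-δ}` time one"), for well-formed problems (`FGProblem.IsStandard`) whose size measure fits
in `O(1)` machine words (`FGProblem.SizeFitsWord` — in print `n` is the input length, so this is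
automatic there): if `(A, n^α) ≤_FG (B, n^β)` and `B` is solvable in time `O(n^{β-ε})` for some
`ε > 0`, then `A` is solvable in time `O(n^{α-ε'})` for some `ε' > 0`. (Restates the prelude's
`FGReducible.trulySubTime_of_sizeFitsWord`, see `trulySubTime_of_fgReducible_of_sizeFitsWord_iff`;
proved: `trulySubTime_of_fgReducible_of_sizeFitsWord_holds`. Without `hsz` the statement — the
retired first transcription `trulySubTime_of_fgReducible` — is false:
`trulySubTime_of_fgReducible_false` in `Literature.Computability.FineGrained.ConjecturesProofs`.)
[cite: VassilevskaWilliamsICM2018, Def. 2.1 and the remark following it] -/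
def trulySubTime_of_fgReducible_of_sizeFitsWord : Prop :=
  ∀ {A B : FGProblem} {α β : ℝ}
    (h : FGReducible A (fun n => (n : ℝ) ^ α) B (fun n => (n : ℝ) ^ β)) (hB : B.TrulySubTime β)
    (hA : A.IsStandard fun n => (n : ℝ) ^ α) (hB' : B.IsStandard fun n => (n : ℝ) ^ β)
    (hsz : A.SizeFitsWord),
    A.TrulySubTime α

/-- The corrected S13 statement is literally the prelude's corrected fact. [folklore] -/
theorem trulySubTime_of_fgReducible_of_sizeFitsWord_iff :
    trulySubTime_of_fgReducible_of_sizeFitsWord ↔ FGReducible.trulySubTime_of_sizeFitsWord :=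
  Iff.rfl

/-- Corrected content of a subcubic equivalence of families (VW–W, J. ACM 65 (2018), Thm. 1.1:
"either all of them have truly subcubic algorithms, or none of them do"), for well-formed families
whose size measures fit in a word, from the corrected transfer property.
[cite: VassilevskaWilliamsICM2018, Def. 2.1 and the remark following it] -/
theorem SubcubicEquivalentFamily.trulySubTime_iff_of_sizeFitsWord
    (hfact : trulySubTime_of_fgReducible_of_sizeFitsWord) {A B : ℕ → FGProblem}
    (h : SubcubicEquivalentFamily A B) (hA : ∀ c, (A c).IsStandard fun n => (n : ℝ) ^ (3 : ℝ))
    (hB : ∀ c, (B c).IsStandard fun n => (n : ℝ) ^ (3 : ℝ)) (hAs : ∀ c, (A c).SizeFitsWord)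
    (hBs : ∀ c, (B c).SizeFitsWord) :
    (∀ c, (A c).TrulySubTime 3) ↔ ∀ c, (B c).TrulySubTime 3 :=
  trulySubTime_iff_of_family_of_sizeFitsWord hfact h.1 h.2 hA hB hAs hBs

/-- The size of an APSP instance (`n`, for an `n × n` matrix encoded in `n ^ 2 + 1` words) fits in
a word. [folklore] -/
theorem APSP_sizeFitsWord (c : ℕ) : (APSP c).SizeFitsWord :=
  FGProblem.sizeFitsWord_of_size_le_length fun W => by
    change W.1.1 ≤ (encodeMatrixWithTop W.1.2).length
    rw [encodeMatrixWithTop_length]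
    exact Nat.le_succ_of_le (Nat.le_self_pow two_ne_zero _)

/-- The size of a Negative Triangle instance fits in a word. [folklore] -/
theorem NegativeTriangle_sizeFitsWord (c : ℕ) : (NegativeTriangle c).SizeFitsWord :=
  FGProblem.sizeFitsWord_of_size_le_length fun W => by
    change W.1.1 ≤ (encodeMatrixWithTop (W.1.2.map (↑))).length
    rw [encodeMatrixWithTop_length]
    exact Nat.le_succ_of_le (Nat.le_self_pow two_ne_zero _)

/-- The size of a `(min,+)`-product instance fits in a word. [folklore] -/
theorem MinPlusProduct_sizeFitsWord (c : ℕ) : (MinPlusProduct c).SizeFitsWord :=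
  FGProblem.sizeFitsWord_of_size_le_length fun M => by
    change M.1.1 ≤ (encodeMatrixWithTop M.1.2.1 ++ encodeMatrixWithTop M.1.2.2).length
    rw [List.length_append, encodeMatrixWithTop_length]
    exact le_trans (Nat.le_succ_of_le (Nat.le_self_pow two_ne_zero _)) (Nat.le_add_right _ _)

/-- The size of a Radius instance (`n + 1` vertices) fits in a word. [folklore] -/
theorem Radius_sizeFitsWord (c : ℕ) : (Radius c).SizeFitsWord :=
  FGProblem.sizeFitsWord_of_size_le_length fun W => by
    change W.1.1 + 1 ≤ (encodeMatrixWithTop W.1.2).length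
    rw [encodeMatrixWithTop_length]
    exact Nat.le_succ_of_le (Nat.le_self_pow two_ne_zero _)

/-- The APSP ⟺ Negative Triangle consequence survives the correction: from the corrected transfer
property, VW–W's subcubic equivalence `subcubicEquivalent_APSP_negativeTriangle` (Thm. 1.1) and
well-formedness of the two families, APSP is truly subcubic for every weight exponent iff
Negative Triangle is (the zoo problems satisfy `SizeFitsWord` unconditionally).
[cite: VassilevskaWilliamsWilliams2018, Thm. 1.1] -/
theorem trulySubTime_APSP_iff_negativeTriangle_of_isStandard_of_sizeFitsWord
    (hfact : trulySubTime_of_fgReducible_of_sizeFitsWord)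
    (hVW : subcubicEquivalent_APSP_negativeTriangle) :
    trulySubTime_APSP_iff_negativeTriangle_of_isStandard :=
  fun hA hN => SubcubicEquivalentFamily.trulySubTime_iff_of_sizeFitsWord hfact hVW hA hN
    APSP_sizeFitsWord NegativeTriangle_sizeFitsWord

/-! ## The corrected transfer property, discharged

`Literature.Computability.Cryptography.FGComplexityProofs` proves the corrected transfer property
(`FGReducible.trulySubTime_of_sizeFitsWord_holds`, by the verified inline simulation
`WordRAM.Inline.SIM`); the corrected S13 and its consequences above therefore hold outright. -/

/-- **fine-grained.S13 (corrected) holds**: discharge of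
`trulySubTime_of_fgReducible_of_sizeFitsWord` by the prelude's
`FGReducible.trulySubTime_of_sizeFitsWord_holds`.
[cite: VassilevskaWilliamsICM2018, Def. 2.1 and the remark following it] -/
theorem trulySubTime_of_fgReducible_of_sizeFitsWord_holds :
    trulySubTime_of_fgReducible_of_sizeFitsWord :=
  FGReducible.trulySubTime_of_sizeFitsWord_holds

/-- Subcubic equivalence of well-formed families whose sizes fit in a word: all members are truly
subcubic or none is (VW–W, J. ACM 65 (2018), Thm. 1.1 pattern), unconditionally.
[cite: VassilevskaWilliamsICM2018, Def. 2.1 and the remark following it] -/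
theorem SubcubicEquivalentFamily.trulySubTime_iff_of_sizeFitsWord_holds {A B : ℕ → FGProblem}
    (h : SubcubicEquivalentFamily A B) (hA : ∀ c, (A c).IsStandard fun n => (n : ℝ) ^ (3 : ℝ))
    (hB : ∀ c, (B c).IsStandard fun n => (n : ℝ) ^ (3 : ℝ)) (hAs : ∀ c, (A c).SizeFitsWord)
    (hBs : ∀ c, (B c).SizeFitsWord) :
    (∀ c, (A c).TrulySubTime 3) ↔ ∀ c, (B c).TrulySubTime 3 :=
  SubcubicEquivalentFamily.trulySubTime_iff_of_sizeFitsWord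
    trulySubTime_of_fgReducible_of_sizeFitsWord_holds h hA hB hAs hBs

/-- APSP is truly subcubic for every weight exponent iff Negative Triangle is, for well-formed
families, *from VW–W's subcubic equivalence alone* (the transfer property being proved).
[cite: VassilevskaWilliamsWilliams2018, Thm. 1.1] -/
theorem trulySubTime_APSP_iff_negativeTriangle_of_isStandard_of_subcubicEquivalent
    (hVW : subcubicEquivalent_APSP_negativeTriangle) :
    trulySubTime_APSP_iff_negativeTriangle_of_isStandard :=
  trulySubTime_APSP_iff_negativeTriangle_of_isStandard_of_sizeFitsWord
    trulySubTime_of_fgReducible_of_sizeFitsWord_holds hVW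

/-! ### Retired name kept as a deprecated alias

The name of the retired uncorrected fact `SubcubicEquivalentFamily.trulySubTime_iff` (see the
module docstring, *Correction and retired facts*, and the note *Retired: the uncorrected family
transfer* in section S12) is re-declared as a deprecated alias of the corrected, proved theorem,
so that it henceforth denotes a true statement and existing textual references keep resolving;
new code uses `SubcubicEquivalentFamily.trulySubTime_iff_of_sizeFitsWord_holds`. (The other
retired fact, `trulySubTime_of_fgReducible`, keeps no alias: its corrected form is the named fact
`trulySubTime_of_fgReducible_of_sizeFitsWord`, proved as `…_holds`.) -/

/-- Deprecated alias of `SubcubicEquivalentFamily.trulySubTime_iff_of_sizeFitsWord_holds` — the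
corrected statement of VW–W, J. ACM 65 (2018), Thm. 1.1 ("either all of them have truly subcubic
algorithms, or none of them do"; §3, Prop. 2 with Def. 3.1 both ways, for "computational problems
on `n × n` matrices", p. 27:11) for two subcubically equivalent families of well-formed problems
whose size measures fit in a word: `A c` is truly subcubic for every weight exponent `c` iff `B c`
is. Until 2026-08-15 this name was the *uncorrected* named fact (no `SizeFitsWord` hypotheses,
arbitrary families), refuted as `SubcubicEquivalentFamily.trulySubTime_iff_false` in
`Literature.Computability.FineGrained.ConjecturesProofs`; do not use it in new code.
[cite: VassilevskaWilliamsWilliams2018, Thm. 1.1; §3, Def. 3.1 and Prop. 2] -/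
@[deprecated SubcubicEquivalentFamily.trulySubTime_iff_of_sizeFitsWord_holds (since := "2026-08-15")]
theorem SubcubicEquivalentFamily.trulySubTime_iff {A B : ℕ → FGProblem}
    (h : SubcubicEquivalentFamily A B) (hA : ∀ c, (A c).IsStandard fun n => (n : ℝ) ^ (3 : ℝ))
    (hB : ∀ c, (B c).IsStandard fun n => (n : ℝ) ^ (3 : ℝ)) (hAs : ∀ c, (A c).SizeFitsWord)
    (hBs : ∀ c, (B c).SizeFitsWord) :
    (∀ c, (A c).TrulySubTime 3) ↔ ∀ c, (B c).TrulySubTime 3 :=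
  h.trulySubTime_iff_of_sizeFitsWord_holds hA hB hAs hBs

end Literature.Computability.FineGrained
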